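import Literature.NumberTheory.Automorphic.ArchTorusOrbitalFubiniSmooth     -- ★ p840553 (V7)-smooth (F0P3a-p02 (g9)): `exists_contDiff_partialOrbital_eq`; brings ★ (V7)-Fubini (h0)∕(h1), ★ FILE A∕B joint properness, pi helpers
import Literature.NumberTheory.Automorphic.ArchOrbitMeasureFubini           -- ★ p841084 (R1-b′) (F0P3a-p07 (g7)): `integral_pi_eq_integral_integral_assemble` (split one place off ANY product of measures)
import Literature.NumberTheory.Automorphic.ArchCompactPlaceOrbitalSmooth    -- ★ p841313 (R3-e) (A-p18 (g24)): `compactSpace_archLocal_of_posDef`, `contDiff_one_…_of_posDef`, `exists_bound_…_Icc_of_posDef`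
import Literature.NumberTheory.Automorphic.UnitaryGroupArchTopology         -- ★ instances `LocallyCompactSpace` ∕ `SecondCountableTopology` on `G′_∞ = arch …` (Haar uniqueness)
import Mathlib.MeasureTheory.Measure.Haar.Unique
import HarnessLib

/-!
# The global torus orbital function of a test function on `G′_∞` is `C¹` along a one-angle curve moving at a DEFINITE place, the other places sitting at regular points
# (Rogawski 1990 §14.5 p. 238 «`v ∈ S₀`»; §8.2–8.3; Borel–Jacquet §4.1; Folland §2.6)

Topic `NumberTheory/Automorphic`; namespace `Literature.NumberTheory.Automorphic.UnitaryGroup`.  THEOREMS ONLY (no `def`, no instance, no notation, no axiom, no named fact,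
no `sorry`).  Cell `pub/hodgecm-mathlib`, ENGINE T1 (crux H413 = `stmt-HodgeConjecture-24833`); floor-1½ preparation, count-neutral, under row (S-c) ∕ `stub_ScCore` of the «SdArch»
pay-down line (`Cruxes/H413/Lines/F0_P3a_SdArch.lean`): brick **(3G-b) «ORBITAL SMOOTHNESS»** — the discharge of the hypothesis `hO` of ★ p841608 `exists_flat_gSide_centralCurve`
(LEAD F0P3a-plan (g9) WORD T8-84 (1), 2026-09-01; author F0P3a-p05 (g12)).  `N`-GENERAL; the `N = 3` token-exact `hO` corollary is ★ `Rogawski1990/ArchEndoscopicCentralCurveOrbitalSmooth`.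

THE MATHEMATICS.  `L` CM, `G′_∞ = U(diag α)(L⁺ ⊗ ℝ) ≃ₜ* Π_w G_w` (`e = archPiEquivCM`), `α_i ≠ 0`.  Fix a place `w₀` where the form is DEFINITE (`σ_{w₀}(diag α)` or its negative positive
definite), so that `G_{w₀}` is COMPACT (★ `compactSpace_archLocal_of_posDef`), and torus coordinates `z` REGULAR AT THE PLACES `w ≠ w₀` (nothing at `w₀`: `z_{w₀}` may be central).
* §1 JOINT PROPERNESS WITH A COMPACT PLACE: `{g ∈ G′_∞ | g·t(z)·g⁻¹ ∈ C}` is compact for compact `C` — closed, and inside `e⁻¹(Π_w S_w)` with `S_{w₀} = G_{w₀}` (compact) and, for `w ≠ w₀`,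
  `S_w = {g_w | g_w·diag(z_w)·g_w⁻¹ ∈ π_w(e C)}` compact by ★ per-place joint properness (`isCompact_setOf_exists_conj_circleDiagonal_mem`, regular `z_w`).  Hence `g ↦ f(g·t(z)·g⁻¹)` has
  compact support for `f ∈ C_c(G′_∞)` — ★ (V2)-glob `hasCompactSupport_comp_conj_archDiagTorus` needed `z` regular EVERYWHERE.
* §2 FUBINI AT THE COMPACT PLACE: ★ (V7) (h4) `integral_comp_conj_archDiagTorus_eq_integral_partial` VERBATIM with «`z` regular» weakened to «`z` regular off `w₀` + `G_{w₀}` compact»: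
  `∫_{G′_∞} f(g·t(z)·g⁻¹) d(e⁻¹_* ⊗ν_w) = ∫_{G_{w₀}} f̃_{z′}(x·diag(z_{w₀})·x⁻¹) dν_{w₀}(x)` ((h1) change of variables, §1 integrability, ★ (R1-b′) `integral_pi_eq_integral_integral_assemble`, reassembly).
* §3 ONE SMOOTH `Θ′` FOR THE WHOLE FIBRE OVER `z′ = (z_w)_{w≠w₀}`: ★ (V7)-smooth `exists_contDiff_partialOrbital_eq` builds `Θ′` (smooth on `M_N(ℂ)`, compact support on `G_{w₀}`) from `z′` ONLY, so
  for EVERY `z″` agreeing with `z` off `w₀`: `∫_{G′_∞} Θ ↑↑(g·t(z″)·g⁻¹) d(e⁻¹_* ⊗ν_w) = ∫_{G_{w₀}} Θ′ ↑↑(x·diag(z″_{w₀})·x⁻¹) dν_{w₀}`.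
* §4 THE HEAD: for ANY Haar measure `ν` on `G′_∞` (`ν = χ • e⁻¹_* ⊗haar_w`, Mathlib `isMulLeftInvariant_eq_smul` + ★ (h0)), `Θ` ambient-smooth with compact support on `G′_∞`, and a torus curve
  `γ(ψ)` with `γ(ψ)_w = z_w` (`w ≠ w₀`, regular) and `γ(ψ)_{w₀} = (ζ_i e^{i c_i ψ})_i`, the orbital function `O(ψ) = ∫_{G′_∞} Θ ↑↑(g·t(γ(ψ))·g⁻¹) dν(g)` is `ContDiff ℝ 1` on ALL of `ℝ` and
  `O`, `O′` are bounded on `[−1, 1]` — ★ A-p18 `contDiff_one_integral_comp_conj_circleDiagonal_of_posDef` ∕ `exists_bound_…_Icc_of_posDef` applied to `Θ′` on the compact `G_{w₀}`.  This is Rogawski's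
  «at `v ∈ S₀` the orbital integral is smooth through the centre» (p. 238), the analytic input that lets `D_G(γ′)Φ(γ′, f′) → 0` there.
HONEST LABEL: HC_CM is proved only modulo the printed citations until rung 0 closes; this file is real analysis over Mathlib + ★ cell files and pays nothing by itself.
Tree search: `rg -n "of_compactSpace" Literature/NumberTheory/Automorphic/ArchTorusOrbital*` → 0; ★ (h2)∕(h4)∕§5 of (V7) all carry `hz : ∀ w, Injective (z w)`.

## References
* [Rogawski1990] J. D. Rogawski, *Automorphic Representations of Unitary Groups in Three Variables*, Ann. of Math. Stud. 123 (1990), §14.5 p. 238; §8.2 pp. 122–124; §8.3 p. 122.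
* [BorelJacquet1979] A. Borel, H. Jacquet, *Automorphic forms and automorphic representations*, PSPM 33.1 (1979), §4.1 (`G_∞ = Π_v G(F_v)`, `dg = Π dg_v`).
* [Folland1995] G. B. Folland, *A Course in Abstract Harmonic Analysis* (1995), §2.2 Thm. 2.20 (uniqueness of Haar measure), §2.6.
* [DeitmarEchterhoff2014] A. Deitmar, S. Echterhoff, *Principles of Harmonic Analysis*, 2nd ed. (2014), Lemma 9.3.3, Thm. 1.5.3.
* [PlatonovRapinchuk1994] V. Platonov, A. Rapinchuk, *Algebraic Groups and Number Theory* (1994), §3.2 Thm 3.1 (anisotropic at `∞` ⇔ compact).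
-/

set_option autoImplicit false

noncomputable section

open MeasureTheory Measure Matrix NumberField NumberField.InfinitePlace NumberField.mixedEmbedding Set Function Topology Filter
open scoped MatrixGroups ContDiff NNReal ComplexOrder

-- the scoped `L^∞`-operator norm on `M_N(ℂ)` and `M_N(L ⊗ ℝ)`, the cell's ambient-smooth convention (★ `ArchimedeanCalculus`, ★ (V7)-smooth)
open scoped Matrix.Norms.Operator

namespace Literature.NumberTheory.Automorphic.UnitaryGroup

variable (L : Type) [Field L] [NumberField L] [IsCMField L] (N : ℕ) (α : Fin N → L)

/-! ## §1 Joint properness with a compact place -/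

/-- **JOINT PROPERNESS WITH A COMPACT PLACE**: for `z` regular at the places `w ≠ w₀`, `G_{w₀}` compact and `C ⊆ G′_∞` compact, `{g | g·t(z)·g⁻¹ ∈ C}` is compact — closed, and
contained in `e⁻¹(Π_w S_w)` with `S_{w₀} = univ` and `S_w` (`w ≠ w₀`) the compact set of ★ `isCompact_setOf_exists_conj_circleDiagonal_mem` at `K = {z_w}`, `C_w = π_w(e C)`.
[cite: Rogawski1990, §8.3 p. 122] [cite: BorelJacquet1979, §4.1] [cite: DeitmarEchterhoff2014, Lemma 9.3.3] -/
theorem isCompact_setOf_conj_archDiagTorus_mem_of_compactSpace (hα : ∀ i, α i ≠ 0) (w₀ : {w : InfinitePlace L // IsComplex w})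
    [CompactSpace (archLocal L N (Matrix.diagonal α) w₀)]
    {z : {w : InfinitePlace L // IsComplex w} → Fin N → Circle} (hz : ∀ w, w ≠ w₀ → Function.Injective (z w))
    {C : Set (arch (↥(maximalRealSubfield L)) L (IsCMField.complexConj L) N (Matrix.diagonal α))} (hC : IsCompact C) :
    IsCompact {g : arch (↥(maximalRealSubfield L)) L (IsCMField.complexConj L) N (Matrix.diagonal α) | g * archDiagTorus L N α z * g⁻¹ ∈ C} := by
  -- the per-place sets `S_w`
  obtain ⟨S, hS⟩ : ∃ S : ∀ w : {w : InfinitePlace L // IsComplex w}, Set (archLocal L N (Matrix.diagonal α) w), S = fun w =>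
      {gw : archLocal L N (Matrix.diagonal α) w | w ≠ w₀ →
        ∃ zw ∈ ({z w} : Set (Fin N → Circle)), gw * ⟨circleDiagonal N zw, circleDiagonal_mem_archLocal_diagonal L N α w zw⟩ * gw⁻¹ ∈
          (fun x => archPiEquivCM N L (Matrix.diagonal α) x w) '' C} := ⟨_, rfl⟩
  have hSc : ∀ w, IsCompact (S w) := by
    intro w
    by_cases hw : w = w₀
    · subst hw
      have hu : S w = Set.univ := by rw [hS]; ext gw; simp only [ne_eq, not_true_eq_false, IsEmpty.forall_iff, mem_setOf_eq, mem_univ]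
      rw [hu]; exact isCompact_univ
    · have hK : IsCompact ({z w} : Set (Fin N → Circle)) := isCompact_singleton
      have h := isCompact_setOf_exists_conj_circleDiagonal_mem L N α w hα hK (by rintro _ ⟨⟩; exact hz w hw)
        (hC.image ((continuous_apply w).comp (archPiEquivCM N L (Matrix.diagonal α)).continuous))
      have hu : S w = {gw : archLocal L N (Matrix.diagonal α) w | ∃ zw ∈ ({z w} : Set (Fin N → Circle)),
          gw * ⟨circleDiagonal N zw, circleDiagonal_mem_archLocal_diagonal L N α w zw⟩ * gw⁻¹ ∈ (fun x => archPiEquivCM N L (Matrix.diagonal α) x w) '' C} := by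
        rw [hS]; ext gw; simp only [ne_eq, hw, not_false_eq_true, forall_const, mem_setOf_eq]
      rw [hu]; exact h
  -- the compact box `B = e⁻¹(Π_w S_w)` contains the set
  have hBc := (isCompact_univ_pi hSc).image (archPiEquivCM N L (Matrix.diagonal α)).symm.continuous
  have hsub : {g : arch (↥(maximalRealSubfield L)) L (IsCMField.complexConj L) N (Matrix.diagonal α) | g * archDiagTorus L N α z * g⁻¹ ∈ C} ⊆
      (archPiEquivCM N L (Matrix.diagonal α)).symm '' (Set.univ.pi S) := by
    intro g hg
    have hpi : archPiEquivCM N L (Matrix.diagonal α) g ∈ Set.univ.pi S := by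
      simp only [Set.mem_univ_pi]
      intro w
      rw [hS]
      intro hw
      have hw' : archPiEquivCM N L (Matrix.diagonal α) (g * archDiagTorus L N α z * g⁻¹) w =
          archPiEquivCM N L (Matrix.diagonal α) g w * ⟨circleDiagonal N (z w), circleDiagonal_mem_archLocal_diagonal L N α w (z w)⟩ *
            (archPiEquivCM N L (Matrix.diagonal α) g w)⁻¹ := by
        rw [map_mul, map_mul, map_inv, Pi.mul_apply, Pi.mul_apply, Pi.inv_apply, archPiEquivCM_archDiagTorus]
      refine ⟨z w, Set.mem_singleton _, ?_⟩
      rw [← hw']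
      exact Set.mem_image_of_mem (fun x => archPiEquivCM N L (Matrix.diagonal α) x w) hg
    have hg' := Set.mem_image_of_mem (archPiEquivCM N L (Matrix.diagonal α)).symm hpi
    rwa [ContinuousMulEquiv.symm_apply_apply] at hg'
  have hclosed : IsClosed {g : arch (↥(maximalRealSubfield L)) L (IsCMField.complexConj L) N (Matrix.diagonal α) | g * archDiagTorus L N α z * g⁻¹ ∈ C} :=
    hC.isClosed.preimage ((continuous_id.mul continuous_const).mul continuous_id.inv)
  exact hBc.of_isClosed_subset hclosed hsub

/-- **Compact support of `g ↦ f(g·t(z)·g⁻¹)` on `G′_∞`** for `z` regular off `w₀` and `G_{w₀}` compact (★ (V2)-glob `hasCompactSupport_comp_conj_archDiagTorus` asks regularity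
everywhere). [cite: Rogawski1990, §8.3 p. 122] [cite: DeitmarEchterhoff2014, Lemma 9.3.3] -/
theorem hasCompactSupport_comp_conj_archDiagTorus_of_compactSpace (hα : ∀ i, α i ≠ 0) (w₀ : {w : InfinitePlace L // IsComplex w})
    [CompactSpace (archLocal L N (Matrix.diagonal α) w₀)]
    {z : {w : InfinitePlace L // IsComplex w} → Fin N → Circle} (hz : ∀ w, w ≠ w₀ → Function.Injective (z w)) {E : Type*} [Zero E]
    (f : arch (↥(maximalRealSubfield L)) L (IsCMField.complexConj L) N (Matrix.diagonal α) → E) (hfc : HasCompactSupport f) :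
    HasCompactSupport fun g : arch (↥(maximalRealSubfield L)) L (IsCMField.complexConj L) N (Matrix.diagonal α) =>
      f (g * archDiagTorus L N α z * g⁻¹) := by
  refine HasCompactSupport.intro (isCompact_setOf_conj_archDiagTorus_mem_of_compactSpace L N α hα w₀ hz hfc.isCompact) fun g hg => ?_
  exact image_eq_zero_of_notMem_tsupport hg

/-! ## §2 Fubini at the compact place -/

variable [MeasurableSpace (arch (↥(maximalRealSubfield L)) L (IsCMField.complexConj L) N (Matrix.diagonal α))]
  [BorelSpace (arch (↥(maximalRealSubfield L)) L (IsCMField.complexConj L) N (Matrix.diagonal α))]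
  [∀ w : {w : InfinitePlace L // IsComplex w}, MeasurableSpace (archLocal L N (Matrix.diagonal α) w)]
  [∀ w : {w : InfinitePlace L // IsComplex w}, BorelSpace (archLocal L N (Matrix.diagonal α) w)]
  [∀ w : {w : InfinitePlace L // IsComplex w}, SecondCountableTopology (archLocal L N (Matrix.diagonal α) w)]
  [∀ w : {w : InfinitePlace L // IsComplex w}, LocallyCompactSpace (archLocal L N (Matrix.diagonal α) w)]

omit [MeasurableSpace (arch (↥(maximalRealSubfield L)) L (IsCMField.complexConj L) N (Matrix.diagonal α))]
  [BorelSpace (arch (↥(maximalRealSubfield L)) L (IsCMField.complexConj L) N (Matrix.diagonal α))]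
  [∀ w : {w : InfinitePlace L // IsComplex w}, BorelSpace (archLocal L N (Matrix.diagonal α) w)]
  [∀ w : {w : InfinitePlace L // IsComplex w}, SecondCountableTopology (archLocal L N (Matrix.diagonal α) w)]
  [∀ w : {w : InfinitePlace L // IsComplex w}, LocallyCompactSpace (archLocal L N (Matrix.diagonal α) w)] [NumberField L] [IsCMField L] in
open scoped Classical in
/-- Reassembly (★ (V7)-Fubini's private `conj_assemble_eq`, re-derived from the public pi helpers of ★ (V7)-smooth): conjugating the assembled family `(x, b)` componentwise by
`(d_w)_w` is the assembled family of the conjugated pieces. [cite: BorelJacquet1979, §4.1] -/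
private theorem conj_assemble_eq' (w₀ : {w : InfinitePlace L // IsComplex w}) (x : archLocal L N (Matrix.diagonal α) w₀)
    (b : ∀ w' : {w : {w : InfinitePlace L // IsComplex w} // ¬ w = w₀}, archLocal L N (Matrix.diagonal α) w'.1)
    (d : ∀ w : {w : InfinitePlace L // IsComplex w}, archLocal L N (Matrix.diagonal α) w) :
    (fun w => (MeasurableEquiv.piEquivPiSubtypeProd (fun w : {w : InfinitePlace L // IsComplex w} => ↥(archLocal L N (Matrix.diagonal α) w)) (· = w₀)).symm
        ((MeasurableEquiv.piUnique fun i : {w : {w : InfinitePlace L // IsComplex w} // w = w₀} => ↥(archLocal L N (Matrix.diagonal α) i.1)).symm x, b) w *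
        d w *
      ((MeasurableEquiv.piEquivPiSubtypeProd (fun w : {w : InfinitePlace L // IsComplex w} => ↥(archLocal L N (Matrix.diagonal α) w)) (· = w₀)).symm
        ((MeasurableEquiv.piUnique fun i : {w : {w : InfinitePlace L // IsComplex w} // w = w₀} => ↥(archLocal L N (Matrix.diagonal α) i.1)).symm x, b) w)⁻¹) =
    (MeasurableEquiv.piEquivPiSubtypeProd (fun w : {w : InfinitePlace L // IsComplex w} => ↥(archLocal L N (Matrix.diagonal α) w)) (· = w₀)).symm
      ((MeasurableEquiv.piUnique fun i : {w : {w : InfinitePlace L // IsComplex w} // w = w₀} => ↥(archLocal L N (Matrix.diagonal α) i.1)).symm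
        (x * d w₀ * x⁻¹), fun w' => b w' * d w'.1 * (b w')⁻¹) := by
  funext w
  rw [piEquivPiSubtypeProd_symm_apply_dite, piEquivPiSubtypeProd_symm_apply_dite]
  by_cases h : w = w₀
  · subst h
    rw [dif_pos rfl, dif_pos rfl]
    erw [piUnique_symm_apply_of_eq (fun j : {w : InfinitePlace L // IsComplex w} => ↥(archLocal L N (Matrix.diagonal α) j)) w x rfl,
      piUnique_symm_apply_of_eq (fun j : {w : InfinitePlace L // IsComplex w} => ↥(archLocal L N (Matrix.diagonal α) j)) w (x * d w * x⁻¹) rfl]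
  · rw [dif_neg h, dif_neg h]

open scoped Classical in
/-- **FUBINI AT A COMPACT PLACE** — ★ (V7) (h4) `integral_comp_conj_archDiagTorus_eq_integral_partial` with «`z` regular» weakened to «`z` regular at the places `w ≠ w₀` and `G_{w₀}`
compact» (the right-hand side is (h4)'s, token for token): `∫_{G′_∞} f(g·t(z)·g⁻¹) d(e⁻¹_* ⊗ν_w) = ∫_{G_{w₀}} f̃_{z′}(x·diag(z_{w₀})·x⁻¹) dν_{w₀}(x)` with `f̃_{z′}` the partial orbital integral over
the places `w ≠ w₀`.  ((h1) change of variables; integrability on `Π_w G_w` by §1; ★ (R1-b′) `integral_pi_eq_integral_integral_assemble`; reassembly.)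
[cite: BorelJacquet1979, §4.1] [cite: Rogawski1990, §8.2 p. 123; §8.3 p. 122] -/
theorem integral_comp_conj_archDiagTorus_eq_integral_partial_of_compactSpace {E : Type*} [NormedAddCommGroup E] [NormedSpace ℝ E]
    (νw : ∀ w : {w : InfinitePlace L // IsComplex w}, Measure (archLocal L N (Matrix.diagonal α) w)) [∀ w, (νw w).IsHaarMeasure]
    (hα : ∀ i, α i ≠ 0) (w₀ : {w : InfinitePlace L // IsComplex w}) [CompactSpace (archLocal L N (Matrix.diagonal α) w₀)]
    (f : arch (↥(maximalRealSubfield L)) L (IsCMField.complexConj L) N (Matrix.diagonal α) → E) (hf : Continuous f) (hfc : HasCompactSupport f)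
    {z : {w : InfinitePlace L // IsComplex w} → Fin N → Circle} (hz : ∀ w, w ≠ w₀ → Function.Injective (z w)) :
    ∫ g, f (g * archDiagTorus L N α z * g⁻¹) ∂((Measure.pi νw).map (archPiEquivCM N L (Matrix.diagonal α)).symm) =
      ∫ x : archLocal L N (Matrix.diagonal α) w₀,
        (fun x' : archLocal L N (Matrix.diagonal α) w₀ =>
          ∫ b : (∀ w' : {w : {w : InfinitePlace L // IsComplex w} // ¬ w = w₀}, archLocal L N (Matrix.diagonal α) w'.1),
            f ((archPiEquivCM N L (Matrix.diagonal α)).symm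
              ((MeasurableEquiv.piEquivPiSubtypeProd (fun w : {w : InfinitePlace L // IsComplex w} => ↥(archLocal L N (Matrix.diagonal α) w)) (· = w₀)).symm
                ((MeasurableEquiv.piUnique fun i : {w : {w : InfinitePlace L // IsComplex w} // w = w₀} => ↥(archLocal L N (Matrix.diagonal α) i.1)).symm x',
                  fun w' => b w' * ⟨circleDiagonal N (z w'.1), circleDiagonal_mem_archLocal_diagonal L N α w'.1 (z w'.1)⟩ * (b w')⁻¹)))
            ∂(Measure.pi fun w' : {w : {w : InfinitePlace L // IsComplex w} // ¬ w = w₀} => νw w'.1))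
        (x * ⟨circleDiagonal N (z w₀), circleDiagonal_mem_archLocal_diagonal L N α w₀ (z w₀)⟩ * x⁻¹) ∂(νw w₀) := by
  -- the integrand on `Π_w G_w`
  set F : (∀ w : {w : InfinitePlace L // IsComplex w}, archLocal L N (Matrix.diagonal α) w) → E :=
    fun y => f ((archPiEquivCM N L (Matrix.diagonal α)).symm
      (fun w => y w * ⟨circleDiagonal N (z w), circleDiagonal_mem_archLocal_diagonal L N α w (z w)⟩ * (y w)⁻¹)) with hF
  -- step 1: change of variables along `e` (★ (h1))
  rw [integral_comp_conj_archDiagTorus_map_symm_pi L N α νw f z]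
  -- `F` is continuous with compact support on `Π_w G_w` (§1), hence integrable for the product Haar measure
  have hFeq : F = (fun g => f (g * archDiagTorus L N α z * g⁻¹)) ∘ (archPiEquivCM N L (Matrix.diagonal α)).symm := by
    funext y
    rw [Function.comp_apply, archPiEquivCM_symm_mul_archDiagTorus_mul_inv]
  have hFc : Continuous F := by
    rw [hFeq]
    exact (hf.comp ((continuous_id.mul continuous_const).mul continuous_inv)).comp (archPiEquivCM N L (Matrix.diagonal α)).symm.continuous
  have hFs : HasCompactSupport F := by
    rw [hFeq]
    exact (hasCompactSupport_comp_conj_archDiagTorus_of_compactSpace L N α hα w₀ hz f hfc).comp_homeomorph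
      (archPiEquivCM N L (Matrix.diagonal α)).symm.toHomeomorph
  have hFi : Integrable F (Measure.pi νw) := hFc.integrable_of_hasCompactSupport hFs
  -- step 2: split the place `w₀` off (★ (R1-b′)) and reassemble
  rw [show (∫ y, f ((archPiEquivCM N L (Matrix.diagonal α)).symm
      (fun w => y w * ⟨circleDiagonal N (z w), circleDiagonal_mem_archLocal_diagonal L N α w (z w)⟩ * (y w)⁻¹)) ∂(Measure.pi νw)) =
      ∫ y, F y ∂(Measure.pi νw) from rfl, integral_pi_eq_integral_integral_assemble L N α w₀ νw F hFi]
  refine integral_congr_ae (Filter.Eventually.of_forall fun x => ?_)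
  refine integral_congr_ae (Filter.Eventually.of_forall fun b => ?_)
  simp only [hF]
  rw [conj_assemble_eq' L N α w₀ x b (fun w => ⟨circleDiagonal N (z w), circleDiagonal_mem_archLocal_diagonal L N α w (z w)⟩)]

/-! ## §3 One smooth per-place test function `Θ′` for the whole fibre over `z′ = (z_w)_{w ≠ w₀}` -/

open scoped Classical in
/-- **ONE SMOOTH `Θ′` FOR EVERY `z″` AGREEING WITH `z` OFF `w₀`** (compact `G_{w₀}`): the `Θ′` of ★ (V7)-smooth `exists_contDiff_partialOrbital_eq` (smooth on `M_N(ℂ)`, compact support on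
`G_{w₀}`, built from `(z_w)_{w≠w₀}` only) satisfies `∫_{G′_∞} Θ ↑↑(g·t(z″)·g⁻¹) d(e⁻¹_* ⊗ν_w) = ∫_{G_{w₀}} Θ′ ↑↑(x·diag(z″_{w₀})·x⁻¹) dν_{w₀}` for EVERY `z″` with `z″_w = z_w` (`w ≠ w₀`) —
in particular along any curve moving only at `w₀`, through the centre. [cite: Rogawski1990, §8.3 p. 122; §14.5 p. 238] [cite: BorelJacquet1979, §4.1] [cite: HormanderALPDO1, Thm. 1.1.9] -/
theorem exists_contDiff_integral_comp_conj_archDiagTorus_eq_of_compactSpace {E : Type*} [NormedAddCommGroup E] [NormedSpace ℝ E] [CompleteSpace E]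
    (νw : ∀ w : {w : InfinitePlace L // IsComplex w}, Measure (archLocal L N (Matrix.diagonal α) w)) [∀ w, (νw w).IsHaarMeasure]
    (hα : ∀ i, α i ≠ 0) (w₀ : {w : InfinitePlace L // IsComplex w}) [CompactSpace (archLocal L N (Matrix.diagonal α) w₀)]
    (Θ : Matrix (Fin N) (Fin N) (mixedSpace L) → E) (hΘ : ContDiff ℝ (⊤ : ℕ∞) Θ)
    (hΘc : HasCompactSupport fun g : arch (↥(maximalRealSubfield L)) L (IsCMField.complexConj L) N (Matrix.diagonal α) =>
      Θ ((g : GL (Fin N) (mixedSpace L)) : Matrix (Fin N) (Fin N) (mixedSpace L)))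
    {z : {w : InfinitePlace L // IsComplex w} → Fin N → Circle} (hz : ∀ w, w ≠ w₀ → Function.Injective (z w)) :
    ∃ Θ' : Matrix (Fin N) (Fin N) ℂ → E, ContDiff ℝ (⊤ : ℕ∞) Θ' ∧
      HasCompactSupport (fun k : archLocal L N (Matrix.diagonal α) w₀ => Θ' ((k : GL (Fin N) ℂ) : Matrix (Fin N) (Fin N) ℂ)) ∧
      ∀ z'' : {w : InfinitePlace L // IsComplex w} → Fin N → Circle, (∀ w, w ≠ w₀ → z'' w = z w) →
        ∫ g, Θ (((g * archDiagTorus L N α z'' * g⁻¹ : arch (↥(maximalRealSubfield L)) L (IsCMField.complexConj L) N (Matrix.diagonal α)) :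
            GL (Fin N) (mixedSpace L)) : Matrix (Fin N) (Fin N) (mixedSpace L)) ∂((Measure.pi νw).map (archPiEquivCM N L (Matrix.diagonal α)).symm) =
          ∫ x : archLocal L N (Matrix.diagonal α) w₀,
            Θ' (((x * ⟨circleDiagonal N (z'' w₀), circleDiagonal_mem_archLocal_diagonal L N α w₀ (z'' w₀)⟩ * x⁻¹ : archLocal L N (Matrix.diagonal α) w₀) :
              GL (Fin N) ℂ) : Matrix (Fin N) (Fin N) ℂ) ∂(νw w₀) := by
  obtain ⟨Θ', h1, h2, h3⟩ := exists_contDiff_partialOrbital_eq L N α νw hα w₀ Θ hΘ hΘc hz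
  refine ⟨Θ', h1, h2, fun z'' hz'' => ?_⟩
  have hΘcont : Continuous fun g : arch (↥(maximalRealSubfield L)) L (IsCMField.complexConj L) N (Matrix.diagonal α) =>
      Θ ((g : GL (Fin N) (mixedSpace L)) : Matrix (Fin N) (Fin N) (mixedSpace L)) :=
    hΘ.continuous.comp (Units.continuous_val.comp continuous_subtype_val)
  have hz''reg : ∀ w, w ≠ w₀ → Function.Injective (z'' w) := fun w hw => by rw [hz'' w hw]; exact hz w hw
  rw [integral_comp_conj_archDiagTorus_eq_integral_partial_of_compactSpace L N α νw hα w₀ _ hΘcont hΘc hz''reg]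
  refine integral_congr_ae (Filter.Eventually.of_forall fun x => ?_)
  have key : ∀ w' : {w : {w : InfinitePlace L // IsComplex w} // ¬ w = w₀},
      (⟨circleDiagonal N (z'' w'.1), circleDiagonal_mem_archLocal_diagonal L N α w'.1 (z'' w'.1)⟩ : archLocal L N (Matrix.diagonal α) w'.1) =
        ⟨circleDiagonal N (z w'.1), circleDiagonal_mem_archLocal_diagonal L N α w'.1 (z w'.1)⟩ := fun w' => by
    simp only [hz'' w'.1 w'.2]
  simp only [key]
  exact (h3 _).symm

/-! ## §4 The head: the global orbital function is `C¹` along a one-angle curve moving at a definite place, for any Haar measure on `G′_∞` -/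

omit [∀ w : {w : InfinitePlace L // IsComplex w}, MeasurableSpace (archLocal L N (Matrix.diagonal α) w)]
  [∀ w : {w : InfinitePlace L // IsComplex w}, BorelSpace (archLocal L N (Matrix.diagonal α) w)]
  [∀ w : {w : InfinitePlace L // IsComplex w}, SecondCountableTopology (archLocal L N (Matrix.diagonal α) w)]
  [∀ w : {w : InfinitePlace L // IsComplex w}, LocallyCompactSpace (archLocal L N (Matrix.diagonal α) w)] in
open scoped Classical in
/-- **(3G-b) «ORBITAL SMOOTHNESS», `N`-GENERAL.**  `ν` ANY Haar measure on `G′_∞ = U(diag α)(L⁺ ⊗ ℝ)`, `w₀` a DEFINITE place, `Θ : M_N(L ⊗ ℝ) → E` smooth with `g ↦ Θ ↑↑g` compactly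
supported on `G′_∞`, `z` regular at the places `w ≠ w₀`, and a torus curve `γ : ℝ → (w ↦ Fin N → S¹)` with `γ(ψ)_w = z_w` for `w ≠ w₀` and `γ(ψ)_{w₀} = (ζ_i e^{i c_i ψ})_i`.  Then
`O(ψ) = ∫_{G′_∞} Θ ↑↑(g·t(γ(ψ))·g⁻¹) dν(g)` is `ContDiff ℝ 1` on all of `ℝ`, and `‖O‖, ‖O′‖ ≤ M` on `[−1, 1]`.  Proof: `ν = χ • e⁻¹_* ⊗haar_w` (Haar uniqueness, ★ (h0)); §3 gives ONE smooth
`Θ′` on `M_N(ℂ)` with `∫ … d(e⁻¹_* ⊗haar_w) = ∫_{G_{w₀}} Θ′ ↑↑(x·diag(γ(ψ)_{w₀})·x⁻¹) d haar` for every `ψ`; ★ A-p18 (R3-e) on the compact `G_{w₀}`.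
[cite: Rogawski1990, §14.5 p. 238; §8.2 pp. 122–123] [cite: Folland1995, §2.2 Thm. 2.20, §2.6] [cite: BorelJacquet1979, §4.1] -/
theorem contDiff_one_integral_comp_conj_archDiagTorus_curve_of_posDef {E : Type*} [NormedAddCommGroup E] [NormedSpace ℝ E] [CompleteSpace E]
    (hα : ∀ i, α i ≠ 0) (w₀ : {w : InfinitePlace L // IsComplex w})
    (hpos : ((Matrix.diagonal α).map (w₀.1.embedding : L →+* ℂ)).PosDef ∨ (-((Matrix.diagonal α).map (w₀.1.embedding : L →+* ℂ))).PosDef)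
    (ν : Measure (arch (↥(maximalRealSubfield L)) L (IsCMField.complexConj L) N (Matrix.diagonal α))) [ν.IsHaarMeasure]
    (Θ : Matrix (Fin N) (Fin N) (mixedSpace L) → E) (hΘ : ContDiff ℝ (⊤ : ℕ∞) Θ)
    (hΘc : HasCompactSupport fun g : arch (↥(maximalRealSubfield L)) L (IsCMField.complexConj L) N (Matrix.diagonal α) =>
      Θ ((g : GL (Fin N) (mixedSpace L)) : Matrix (Fin N) (Fin N) (mixedSpace L)))
    {z : {w : InfinitePlace L // IsComplex w} → Fin N → Circle} (hz : ∀ w, w ≠ w₀ → Function.Injective (z w))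
    (ζ : Fin N → Circle) (c : Fin N → ℝ) (γ : ℝ → {w : InfinitePlace L // IsComplex w} → Fin N → Circle)
    (hγ : ∀ ψ w, w ≠ w₀ → γ ψ w = z w) (hγ₀ : ∀ ψ, γ ψ w₀ = fun i => ζ i * Circle.exp (c i * ψ)) :
    ContDiff ℝ 1 (fun ψ : ℝ => ∫ g, Θ (((g * archDiagTorus L N α (γ ψ) * g⁻¹ : arch (↥(maximalRealSubfield L)) L (IsCMField.complexConj L) N (Matrix.diagonal α)) :
        GL (Fin N) (mixedSpace L)) : Matrix (Fin N) (Fin N) (mixedSpace L)) ∂ν) ∧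
      ∃ M : ℝ, ∀ ψ ∈ Set.Icc (-1 : ℝ) 1,
        ‖∫ g, Θ (((g * archDiagTorus L N α (γ ψ) * g⁻¹ : arch (↥(maximalRealSubfield L)) L (IsCMField.complexConj L) N (Matrix.diagonal α)) :
            GL (Fin N) (mixedSpace L)) : Matrix (Fin N) (Fin N) (mixedSpace L)) ∂ν‖ ≤ M ∧
        ‖deriv (fun ψ : ℝ => ∫ g, Θ (((g * archDiagTorus L N α (γ ψ) * g⁻¹ : arch (↥(maximalRealSubfield L)) L (IsCMField.complexConj L) N (Matrix.diagonal α)) :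
            GL (Fin N) (mixedSpace L)) : Matrix (Fin N) (Fin N) (mixedSpace L)) ∂ν) ψ‖ ≤ M := by
  -- the per-place groups `G_w`: Borel σ-algebras, second countable, locally compact (★), `G_{w₀}` compact (★ A-p18)
  letI : ∀ w : {w : InfinitePlace L // IsComplex w}, MeasurableSpace (archLocal L N (Matrix.diagonal α) w) := fun w => borel _
  haveI : ∀ w : {w : InfinitePlace L // IsComplex w}, BorelSpace (archLocal L N (Matrix.diagonal α) w) := fun w => ⟨rfl⟩
  haveI : ∀ w : {w : InfinitePlace L // IsComplex w}, SecondCountableTopology (archLocal L N (Matrix.diagonal α) w) :=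
    fun w => secondCountableTopology_archLocal L N (Matrix.diagonal α) w
  haveI : ∀ w : {w : InfinitePlace L // IsComplex w}, LocallyCompactSpace (archLocal L N (Matrix.diagonal α) w) :=
    fun w => locallyCompactSpace_archLocal L N (Matrix.diagonal α) w
  haveI : CompactSpace (archLocal L N (Matrix.diagonal α) w₀) := compactSpace_archLocal_of_posDef L N α w₀ hpos
  -- per-place Haar measures and the product-measure Haar measure `μ₀ = e⁻¹_* ⊗haar_w` (★ (h0)); `ν = χ • μ₀`
  set νw : ∀ w : {w : InfinitePlace L // IsComplex w}, Measure (archLocal L N (Matrix.diagonal α) w) := fun w => Measure.haar with hνw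
  haveI hμ₀ : ((Measure.pi νw).map (archPiEquivCM N L (Matrix.diagonal α)).symm).IsHaarMeasure := isHaarMeasure_map_archPiEquivCM_symm_pi L N α νw
  have hν : ν = ν.haarScalarFactor ((Measure.pi νw).map (archPiEquivCM N L (Matrix.diagonal α)).symm) • (Measure.pi νw).map (archPiEquivCM N L (Matrix.diagonal α)).symm :=
    Measure.isMulLeftInvariant_eq_smul ν _
  set χ : ℝ≥0 := ν.haarScalarFactor ((Measure.pi νw).map (archPiEquivCM N L (Matrix.diagonal α)).symm) with hχ
  -- one smooth `Θ′` for the whole curve (§3)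
  obtain ⟨Θ', hΘ'd, -, hΘ'eq⟩ := exists_contDiff_integral_comp_conj_archDiagTorus_eq_of_compactSpace L N α νw hα w₀ Θ hΘ hΘc hz
  -- the orbital function is `χ •` A-p18's per-place orbital function of `Θ′` at `w₀`
  have hO : (fun ψ : ℝ => ∫ g, Θ (((g * archDiagTorus L N α (γ ψ) * g⁻¹ : arch (↥(maximalRealSubfield L)) L (IsCMField.complexConj L) N (Matrix.diagonal α)) :
        GL (Fin N) (mixedSpace L)) : Matrix (Fin N) (Fin N) (mixedSpace L)) ∂ν) =
      fun ψ : ℝ => (χ : ℝ) • ∫ k : archLocal L N (Matrix.diagonal α) w₀,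
        Θ' ((((k * ⟨circleDiagonal N fun i => ζ i * Circle.exp (c i * ψ), circleDiagonal_mem_archLocal_diagonal L N α w₀ _⟩ * k⁻¹ :
          archLocal L N (Matrix.diagonal α) w₀) : GL (Fin N) ℂ) : Matrix (Fin N) (Fin N) ℂ)) ∂(νw w₀) := by
    funext ψ
    rw [hν, integral_smul_nnreal_measure, NNReal.smul_def, hΘ'eq (γ ψ) (hγ ψ), hγ₀ ψ]
  have hA : ContDiff ℝ 1 Θ' := hΘ'd.of_le (by exact_mod_cast le_top)
  have hP := contDiff_one_integral_comp_conj_circleDiagonal_of_posDef L N α w₀ hpos (νw w₀) Θ' hA ζ c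
  obtain ⟨M, hM⟩ := exists_bound_integral_comp_conj_circleDiagonal_Icc_of_posDef L N α w₀ hpos (νw w₀) Θ' hA ζ c
  refine ⟨by rw [hO]; exact contDiff_const.smul hP, (χ : ℝ) * M, fun ψ hψ => ⟨?_, ?_⟩⟩
  · have hOψ := congrFun hO ψ
    rw [hOψ, _root_.norm_smul, Real.norm_of_nonneg χ.coe_nonneg]
    exact mul_le_mul_of_nonneg_left (hM ψ hψ).1 χ.coe_nonneg
  · rw [hO, deriv_fun_const_smul _ ((hP.differentiable one_ne_zero) ψ), _root_.norm_smul, Real.norm_of_nonneg χ.coe_nonneg]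
    exact mul_le_mul_of_nonneg_left (hM ψ hψ).2 χ.coe_nonneg

end Literature.NumberTheory.Automorphic.UnitaryGroup

end
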